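import Literature.NumberTheory.LFunctions.ClassGroupLFunctionLogDerivLeft
import HarnessLib

/-!
# Zeros of `L(s, χ)` and `L(1 − s, χ⁻¹)`: the symmetry of the functional equation, with multiplicity

Topic `Literature/NumberTheory/LFunctions`, namespace `Literature.NumberTheory.LFunctions.NumberField`.
Everything here is PROVED (theorems only; no named facts).

From the closed functional equation `γ(1 − s) L(1 − s, χ) = χ([𝔡_K]) γ(s) L(s, χ⁻¹)` of the tree
(`completedClassGroupLFunction_one_sub`, valid off the integers, where the gamma factor `γ` is
analytic and non-zero) we read off, for every class group character `χ` of a number field `K` and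
every non-integral `s`:

* `analyticAt_classGroupLFunction`, `analyticAt_dedekindGammaFactor` — analyticity off `1` / off `ℤ_{≤0}`;
* `analyticOrderAt_classGroupLFunction_one_sub` — **`ord_{1−s} L(·, χ) = ord_s L(·, χ⁻¹)`**;
* `classGroupLFunction_one_sub_eq_zero_iff` — `L(1 − s, χ) = 0 ↔ L(s, χ⁻¹) = 0`;
* the same for the entire `L₀` (`χ ≠ 1`): `analyticOrderAt_classGroupLFunction₀_one_sub`.

These give the reflection `ρ ↦ 1 − ρ` between the zeros of `L(s, χ)` with `β < 1/2` and the zeros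
of `L(s, χ⁻¹)` with `β > 1/2` used to count zeros in windows and to bound `L'/L` on the left half of
the critical strip (Montgomery–Vaughan Lemmas 12.6–12.8 over `K`).

## References

* J. Neukirch, *Algebraic Number Theory*, VII (8.6) (functional equation). [NeukirchANT1999]
* H. L. Montgomery, R. C. Vaughan, *Multiplicative Number Theory I*, §10.2, Lemma 12.8. [MontgomeryVaughan2007]
-/

noncomputable section

open scoped NumberField nonZeroDivisors Real
open NumberField Complex Filter Topology Set

namespace Literature.NumberTheory.LFunctions.NumberField

variable {K : Type*} [Field K] [NumberField K]

/-! ### Analyticity -/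

/-- `L(s, χ)` is analytic at every `s ≠ 1`. [folklore] -/
theorem analyticAt_classGroupLFunction (χ : ClassGroup (𝓞 K) →* ℂˣ) {s : ℂ} (hs : s ≠ 1) :
    AnalyticAt ℂ (classGroupLFunction K χ) s :=
  (differentiableOn_classGroupLFunction χ).analyticAt (isOpen_compl_singleton.mem_nhds hs)

omit [NumberField K] in
/-- The set of non-positive integers `{0, −1, −2, …}` is closed, so its complement is open. [folklore] -/
theorem isOpen_compl_negNat : IsOpen {s : ℂ | ∀ m : ℕ, s ≠ -m} := by
  rw [isOpen_iff_mem_nhds]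
  intro s hs
  -- a small ball around `s` avoids the (discrete) set `{0, −1, −2, …}`
  have hclosed : IsClosed (Set.range (fun n : ℤ ↦ (n : ℂ))) :=
    Complex.isometry_intCast.isClosedEmbedding.isClosed_range
  by_cases hint : ∃ n : ℤ, s = n
  · obtain ⟨n, rfl⟩ := hint
    have hn : 0 < n := by
      by_contra hle
      push Not at hle
      obtain ⟨m, hm⟩ := Int.exists_eq_neg_ofNat hle
      exact hs m (by rw [hm]; push_cast; ring)
    have hball : Metric.ball (n : ℂ) 1 ∈ 𝓝 (n : ℂ) := Metric.ball_mem_nhds _ one_pos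
    filter_upwards [hball] with z hz m hzm
    rw [Metric.mem_ball, dist_eq_norm, hzm] at hz
    have : ‖(-(m : ℂ)) - (n : ℂ)‖ = ((m : ℝ) + n) := by
      rw [show (-(m : ℂ)) - (n : ℂ) = -(((m : ℝ) + (n : ℝ) : ℝ) : ℂ) by push_cast; ring, norm_neg, Complex.norm_real,
        Real.norm_of_nonneg (by positivity)]
    rw [this] at hz
    have hn1 : (1 : ℝ) ≤ n := by exact_mod_cast hn
    linarith [(Nat.cast_nonneg m : (0:ℝ) ≤ m)]
  · push Not at hint
    have hopen : IsOpen (Set.range (fun n : ℤ ↦ (n : ℂ)))ᶜ := hclosed.isOpen_compl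
    have hmem : s ∈ (Set.range (fun n : ℤ ↦ (n : ℂ)))ᶜ := by
      rintro ⟨n, hn⟩; exact hint n hn.symm
    filter_upwards [hopen.mem_nhds hmem] with z hz m hzm
    exact hz ⟨-m, by rw [hzm]; push_cast; ring⟩

/-- The gamma factor `γ(s) = |d_K|^{s/2} Γ_ℝ(s)^{r₁} Γ_ℂ(s)^{r₂}` is analytic off `{0, −1, −2, …}`. [folklore] -/
theorem analyticAt_dedekindGammaFactor {s : ℂ} (hs : ∀ m : ℕ, s ≠ -m) :
    AnalyticAt ℂ (dedekindGammaFactor K) s := by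
  have hd : DifferentiableOn ℂ (dedekindGammaFactor K) {s : ℂ | ∀ m : ℕ, s ≠ -m} :=
    fun z hz ↦ (differentiableAt_dedekindGammaFactor hz).differentiableWithinAt
  exact hd.analyticAt (isOpen_compl_negNat.mem_nhds hs)

omit [NumberField K] in
/-- A non-integer is not a non-positive integer. [folklore] -/
theorem ne_neg_nat_of_ne_int {s : ℂ} (hs : ∀ n : ℤ, s ≠ n) (m : ℕ) : s ≠ -m :=
  fun h ↦ hs (-m) (by rw [h]; push_cast; ring)

omit [NumberField K] in
/-- If `s ∉ ℤ` then `1 − s ∉ ℤ`. [folklore] -/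
theorem one_sub_ne_int {s : ℂ} (hs : ∀ n : ℤ, s ≠ n) (n : ℤ) : 1 - s ≠ n := by
  intro h
  exact hs (1 - n) (by rw [show (((1 - n : ℤ)) : ℂ) = 1 - (n : ℂ) by push_cast; ring, ← h]; ring)

omit [NumberField K] in
/-- The non-integers form an open set. [folklore] -/
theorem isOpen_compl_int : IsOpen {s : ℂ | ∀ n : ℤ, s ≠ n} := by
  have hclosed : IsClosed (Set.range (fun n : ℤ ↦ (n : ℂ))) :=
    Complex.isometry_intCast.isClosedEmbedding.isClosed_range
  have : {s : ℂ | ∀ n : ℤ, s ≠ n} = (Set.range (fun n : ℤ ↦ (n : ℂ)))ᶜ := by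
    ext s
    simp only [Set.mem_setOf_eq, Set.mem_compl_iff, Set.mem_range, not_exists]
    exact ⟨fun h n hn ↦ h n hn.symm, fun h n hn ↦ h n hn.symm⟩
  rw [this]; exact hclosed.isOpen_compl

/-! ### Orders under the functional equation -/

omit [NumberField K] in
/-- Multiplying by an analytic function that does not vanish at `z₀` does not change the order. [folklore] -/
theorem analyticOrderAt_mul_of_ne_zero {f u : ℂ → ℂ} {z₀ : ℂ} (hu : AnalyticAt ℂ u z₀) (hu0 : u z₀ ≠ 0)
    (hf : AnalyticAt ℂ f z₀) : analyticOrderAt (fun z ↦ u z * f z) z₀ = analyticOrderAt f z₀ := by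
  rw [show (fun z ↦ u z * f z) = u * f from rfl, analyticOrderAt_mul hu hf, hu.analyticOrderAt_eq_zero.mpr hu0,
    zero_add]

omit [NumberField K] in
/-- The order of `z ↦ f(1 − z)` at `z₀` is the order of `f` at `1 − z₀`. [folklore] -/
theorem analyticOrderAt_comp_one_sub (f : ℂ → ℂ) (z₀ : ℂ) :
    analyticOrderAt (fun z ↦ f (1 - z)) z₀ = analyticOrderAt f (1 - z₀) := by
  have hg : AnalyticAt ℂ (fun z : ℂ ↦ 1 - z) z₀ := analyticAt_const.sub analyticAt_id
  have hg' : deriv (fun z : ℂ ↦ 1 - z) z₀ ≠ 0 := by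
    rw [show (fun z : ℂ ↦ 1 - z) = fun z ↦ (1 : ℂ) - id z from rfl, deriv_const_sub, deriv_id]; norm_num
  exact analyticOrderAt_comp_of_deriv_ne_zero (f := f) hg hg'

/-- **The symmetry of the zeros, with multiplicity**: for `s ∉ ℤ`,
`ord_{1−s} L(·, χ) = ord_s L(·, χ⁻¹)`. [cite: MontgomeryVaughan2007, §10.2 (Corollary 10.8 analogue)] -/
theorem analyticOrderAt_classGroupLFunction_one_sub (χ : ClassGroup (𝓞 K) →* ℂˣ) {s : ℂ} (hs : ∀ n : ℤ, s ≠ n) :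
    analyticOrderAt (classGroupLFunction K χ) (1 - s) = analyticOrderAt (classGroupLFunction K χ⁻¹) s := by
  set γ := dedekindGammaFactor K with hγ
  set W : ℂ := (χ (differentClass K) : ℂ) with hW
  have hW0 : W ≠ 0 := fun h ↦ by
    have := norm_rootNumber (K := K) χ
    rw [← hW, h, norm_zero] at this; exact zero_ne_one this
  -- the functional equation near `s`
  have hFE : (fun z ↦ γ (1 - z) * classGroupLFunction K χ (1 - z)) =ᶠ[𝓝 s]
      fun z ↦ (W * γ z) * classGroupLFunction K χ⁻¹ z := by
    filter_upwards [isOpen_compl_int.mem_nhds hs] with z hz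
    rw [completedClassGroupLFunction_one_sub χ hz, mul_assoc]
  have h1s : ∀ n : ℤ, 1 - s ≠ n := one_sub_ne_int hs
  have hs1 : s ≠ 1 := fun h ↦ hs 1 (by rw [h]; simp)
  have h1s1 : 1 - s ≠ 1 := fun h ↦ hs 0 (by simp at h ⊢; exact h)
  have hγs : AnalyticAt ℂ γ s := analyticAt_dedekindGammaFactor (ne_neg_nat_of_ne_int hs)
  have hγ1s : AnalyticAt ℂ γ (1 - s) := analyticAt_dedekindGammaFactor (ne_neg_nat_of_ne_int h1s)
  have hγs0 : γ s ≠ 0 := dedekindGammaFactor_ne_zero hs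
  have hγ1s0 : γ (1 - s) ≠ 0 := dedekindGammaFactor_ne_zero h1s
  have hLs : AnalyticAt ℂ (classGroupLFunction K χ⁻¹) s := analyticAt_classGroupLFunction χ⁻¹ hs1
  have hL1s : AnalyticAt ℂ (classGroupLFunction K χ) (1 - s) := analyticAt_classGroupLFunction χ h1s1
  -- orders
  have hleft : analyticOrderAt (fun z ↦ γ (1 - z) * classGroupLFunction K χ (1 - z)) s =
      analyticOrderAt (classGroupLFunction K χ) (1 - s) := by
    have hu : AnalyticAt ℂ (fun z ↦ γ (1 - z)) s := by
      have : AnalyticAt ℂ γ ((fun z : ℂ ↦ 1 - z) s) := hγ1s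
      exact this.comp (analyticAt_const.sub analyticAt_id)
    have hf : AnalyticAt ℂ (fun z ↦ classGroupLFunction K χ (1 - z)) s := by
      have : AnalyticAt ℂ (classGroupLFunction K χ) ((fun z : ℂ ↦ 1 - z) s) := hL1s
      exact this.comp (analyticAt_const.sub analyticAt_id)
    rw [analyticOrderAt_mul_of_ne_zero hu hγ1s0 hf]
    exact analyticOrderAt_comp_one_sub _ s
  have hright : analyticOrderAt (fun z ↦ (W * γ z) * classGroupLFunction K χ⁻¹ z) s =
      analyticOrderAt (classGroupLFunction K χ⁻¹) s :=
    analyticOrderAt_mul_of_ne_zero (analyticAt_const.mul hγs) (mul_ne_zero hW0 hγs0) hLs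
  rw [← hleft, analyticOrderAt_congr hFE, hright]

/-- **The symmetry of the zeros**: for `s ∉ ℤ`, `L(1 − s, χ) = 0 ↔ L(s, χ⁻¹) = 0`. [folklore] -/
theorem classGroupLFunction_one_sub_eq_zero_iff (χ : ClassGroup (𝓞 K) →* ℂˣ) {s : ℂ} (hs : ∀ n : ℤ, s ≠ n) :
    classGroupLFunction K χ (1 - s) = 0 ↔ classGroupLFunction K χ⁻¹ s = 0 := by
  have hs1 : s ≠ 1 := fun h ↦ hs 1 (by rw [h]; simp)
  have h1s1 : 1 - s ≠ 1 := fun h ↦ hs 0 (by simp at h ⊢; exact h)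
  have hL1s : AnalyticAt ℂ (classGroupLFunction K χ) (1 - s) := analyticAt_classGroupLFunction χ h1s1
  have hLs : AnalyticAt ℂ (classGroupLFunction K χ⁻¹) s := analyticAt_classGroupLFunction χ⁻¹ hs1
  have h := analyticOrderAt_classGroupLFunction_one_sub χ hs
  constructor
  · intro h0
    by_contra hne
    have h2 : analyticOrderAt (classGroupLFunction K χ⁻¹) s = 0 := hLs.analyticOrderAt_eq_zero.mpr hne
    rw [h2] at h
    exact (hL1s.analyticOrderAt_eq_zero.mp h) h0
  · intro h0
    by_contra hne
    have h2 : analyticOrderAt (classGroupLFunction K χ) (1 - s) = 0 := hL1s.analyticOrderAt_eq_zero.mpr hne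
    rw [h2] at h
    exact (hLs.analyticOrderAt_eq_zero.mp h.symm) h0

omit [NumberField K] in
/-- A point of the open critical strip is not an integer. [folklore] -/
theorem ne_int_of_mem_strip {s : ℂ} (h0 : 0 < s.re) (h1 : s.re < 1) (n : ℤ) : s ≠ n := by
  intro h
  have hre : s.re = n := by rw [h]; simp
  rw [hre] at h0 h1
  have h0' : (0 : ℤ) < n := by exact_mod_cast h0
  have h1' : n < (1 : ℤ) := by exact_mod_cast h1
  omega

omit [NumberField K] in
/-- A point with non-zero imaginary part is not an integer: the specialisation of Mathlib's
`ne_of_apply_ne` to `Complex.im` (`(n : ℂ).im = 0` definitionally), kept under this readable name for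
its users in `ClassGroupLFunctionStripBounds.lean` (librarian dedup note 2026-08-16, work item
dedup-01232). [folklore] -/
theorem ne_int_of_im_ne_zero {s : ℂ} (h : s.im ≠ 0) (n : ℤ) : s ≠ n :=
  ne_of_apply_ne im h

/-- The entire `L₀` agrees with `L` near every `s ≠ 1`, so the orders agree there. [folklore] -/
theorem analyticOrderAt_classGroupLFunction₀_eq {χ : ClassGroup (𝓞 K) →* ℂˣ} (hχ : χ ≠ 1) {s : ℂ} (hs : s ≠ 1) :
    analyticOrderAt (classGroupLFunction₀ K χ) s = analyticOrderAt (classGroupLFunction K χ) s := by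
  refine analyticOrderAt_congr ?_
  filter_upwards [isOpen_compl_singleton.mem_nhds hs] with z hz
  exact classGroupLFunction₀_eq χ hz hχ

/-- **The symmetry for the entire `L₀`** (`χ ≠ 1`, `s ∉ ℤ`):
`ord_{1−s} L₀(·, χ) = ord_s L₀(·, χ⁻¹)`. [folklore] -/
theorem analyticOrderAt_classGroupLFunction₀_one_sub {χ : ClassGroup (𝓞 K) →* ℂˣ} (hχ : χ ≠ 1) {s : ℂ}
    (hs : ∀ n : ℤ, s ≠ n) :
    analyticOrderAt (classGroupLFunction₀ K χ) (1 - s) = analyticOrderAt (classGroupLFunction₀ K χ⁻¹) s := by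
  have hχ' : χ⁻¹ ≠ 1 := fun h ↦ hχ (by
    ext C
    have := congrArg (fun ψ : ClassGroup (𝓞 K) →* ℂˣ ↦ ((ψ C)⁻¹ : ℂˣ)) h
    simpa using this)
  have hs1 : s ≠ 1 := fun h ↦ hs 1 (by rw [h]; simp)
  have h1s1 : 1 - s ≠ 1 := fun h ↦ hs 0 (by simp at h ⊢; exact h)
  rw [analyticOrderAt_classGroupLFunction₀_eq hχ h1s1, analyticOrderAt_classGroupLFunction₀_eq hχ' hs1]
  exact analyticOrderAt_classGroupLFunction_one_sub χ hs

/-- For `χ ≠ 1` and `s ∉ ℤ`: `L₀(1 − s, χ) = 0 ↔ L₀(s, χ⁻¹) = 0`. [folklore] -/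
theorem classGroupLFunction₀_one_sub_eq_zero_iff {χ : ClassGroup (𝓞 K) →* ℂˣ} (hχ : χ ≠ 1) {s : ℂ}
    (hs : ∀ n : ℤ, s ≠ n) :
    classGroupLFunction₀ K χ (1 - s) = 0 ↔ classGroupLFunction₀ K χ⁻¹ s = 0 := by
  have hχ' : χ⁻¹ ≠ 1 := fun h ↦ hχ (by
    ext C
    have := congrArg (fun ψ : ClassGroup (𝓞 K) →* ℂˣ ↦ ((ψ C)⁻¹ : ℂˣ)) h
    simpa using this)
  have hs1 : s ≠ 1 := fun h ↦ hs 1 (by rw [h]; simp)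
  have h1s1 : 1 - s ≠ 1 := fun h ↦ hs 0 (by simp at h ⊢; exact h)
  rw [classGroupLFunction₀_eq χ h1s1 hχ, classGroupLFunction₀_eq χ⁻¹ hs1 hχ']
  exact classGroupLFunction_one_sub_eq_zero_iff χ hs

/-- The multiplicities (`analyticOrderNatAt`) of the entire `L₀` agree under `ρ ↦ 1 − ρ`, `χ ↦ χ⁻¹`
(`χ ≠ 1`, `s ∉ ℤ`). [folklore] -/
theorem analyticOrderNatAt_classGroupLFunction₀_one_sub {χ : ClassGroup (𝓞 K) →* ℂˣ} (hχ : χ ≠ 1) {s : ℂ}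
    (hs : ∀ n : ℤ, s ≠ n) :
    analyticOrderNatAt (classGroupLFunction₀ K χ) (1 - s) = analyticOrderNatAt (classGroupLFunction₀ K χ⁻¹) s := by
  rw [analyticOrderNatAt, analyticOrderNatAt, analyticOrderAt_classGroupLFunction₀_one_sub hχ hs]

end Literature.NumberTheory.LFunctions.NumberField

end
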